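import Summits.ResolutionOfSingularities.KangarooAtlas.MizutaniPIndependent
import Mathlib.Order.Zorn
import Mathlib.FieldTheory.IntermediateField.Adjoin.Basic
import HarnessLib

/-!
# `p`-bases by Zorn: every finite `p`-independent family extends to a `p`-basis of `k`

Cell `pub-rosobs`, Mizutani enclosure (seat mizutani-encloser-2, gen 9).  AI-written; *AI review is weaker than expert review*;
NOT a resolution-of-singularities theorem (summit relevance C).

Mizutani 1973, p. 88 / p. 95, works with a `p`-basis `Λ` of `k` over `k^p` (an arbitrary imperfect field).  The tree so far has the FINITE
notion `PIndep p j b` (`b : Fin s → k`; `MizutaniPIndependent`) and, for fields of finite `p`-degree, finite `p`-bases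
(`MizutaniLemma27PBasis.exists_pBasis_of_finiteDimensional`).  This file supplies the general existence statement, the first step of the
route to Lemma 2.4 / 2.7 over fields of INFINITE `p`-degree recorded in the seat HANDOFF (the complement field `k^{p^e}(Λ ∖ b)` over which
`k` is a finite root tower with generators `b`):

* `PIndep.injective_of_one_le` — a `p`-independent family has no repetitions; `PIndep.of_range_subset` — an injective family drawn from
  a `p`-independent one is `p`-independent (sub-box of monomials);
* `pow_mem_adjoin_set`, `adjoin_frobPow_eq_top_all` — `k = k^p(Λ) ⇒ k = k^{p^j}(Λ)` for an arbitrary set `Λ`;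
* **`exists_pBasis_superset`** — for every finite `p`-independent `b` there is a set `Λ ⊇ range b` all of whose finite injective
  subfamilies are `p`-independent and with `k = k^p(Λ)` (Zorn on such sets; a maximal one generates, by the exchange lemma `PIndep.cons`);
  `exists_pBasis` (some `p`-basis), `adjoin_frobPow_pBasis_eq_top` (`k = k^{p^j}(Λ)` for every `j`).

References: [Mizutani1973HironakaGroupSchemes] Lemma 2.4 (p. 88: «Let Λ be a p-basis of k over k^p»), Remark 2.10 (p. 95); N. Bourbaki,
Algèbre V §13 (p-bases) [folklore].
-/

noncomputable section

open Literature.AlgebraicGeometry.Resolution.HironakaScheme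

namespace Summit.ResolutionOfSingularities.KangarooAtlas.Mizutani

universe u

section PBasis

variable {k : Type u} [Field k] {p : ℕ} [hp : Fact p.Prime] [CharP k p]

/-- A `p`-independent family (level `j ≥ 1`) is injective: `b_i = b_{i'}` would make two box monomials coincide. [folklore] -/
theorem PIndep.injective_of_one_le {j s : ℕ} {b : Fin s → k} (hb : PIndep p j b) (hj : 1 ≤ j) : Function.Injective b := by
  classical
  have h1 : 1 < p ^ j := lt_of_lt_of_le hp.out.one_lt (by simpa using Nat.pow_le_pow_right hp.out.pos hj)
  have h0 : 0 < p ^ j := lt_trans Nat.zero_lt_one h1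
  set W : Fin s → Fin s → Fin (p ^ j) := fun i₀ l => if l = i₀ then ⟨1, h1⟩ else ⟨0, h0⟩ with hWdef
  have hW : ∀ i₀ : Fin s, fmon b (W i₀) = b i₀ := fun i₀ => by
    unfold fmon
    rw [Finset.prod_eq_single i₀ (fun l _ hl => by rw [hWdef]; dsimp only; rw [if_neg hl, pow_zero])
      (fun h => absurd (Finset.mem_univ _) h)]
    rw [hWdef]; dsimp only; rw [if_pos rfl, pow_one]
  intro i i' h
  by_contra hne
  have hinj := (LinearIndependent.injective hb) (show fmon b (W i) = fmon b (W i') by rw [hW, hW, h])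
  have := congrFun hinj i
  rw [hWdef] at this; dsimp only at this
  rw [if_pos rfl, if_neg hne] at this
  exact absurd (congrArg Fin.val this) (by norm_num)

/-- **Sub-families of a `p`-independent family are `p`-independent**: if `g` is injective with `range g ⊆ range b`, `b`
`p`-independent at level `j`, then so is `g` (its box monomials are box monomials of `b`). [folklore] -/
theorem PIndep.of_range_subset {j s m : ℕ} {b : Fin s → k} (hb : PIndep p j b) {g : Fin m → k}
    (hg : Function.Injective g) (h : Set.range g ⊆ Set.range b) : PIndep p j g := by
  classical
  have h0 : 0 < p ^ j := pow_pos hp.out.pos j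
  have hex : ∀ i : Fin m, ∃ l : Fin s, b l = g i := fun i => h ⟨i, rfl⟩
  choose ι hι using hex
  have hιinj : Function.Injective ι := fun i i' hii' => hg (by rw [← hι i, ← hι i', hii'])
  -- extend a box index of `g` to one of `b` by zero
  set ext : (Fin m → Fin (p ^ j)) → (Fin s → Fin (p ^ j)) := fun W => Function.extend ι W fun _ => ⟨0, h0⟩ with hext
  have hext_app : ∀ W i, ext W (ι i) = W i := fun W i => by rw [hext]; exact hιinj.extend_apply _ _ _
  have hext_out : ∀ W l, (¬ ∃ i, ι i = l) → ext W l = ⟨0, h0⟩ := fun W l hl => by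
    rw [hext]; exact Function.extend_apply' _ _ _ hl
  have hinj : Function.Injective ext := fun W W' hWW => funext fun i => by rw [← hext_app W i, ← hext_app W' i, hWW]
  have hmon : ∀ W, fmon b (ext W) = fmon g W := fun W => by
    unfold fmon
    rw [← Finset.prod_subset (Finset.subset_univ (Finset.univ.image ι))
      (fun l _ hl => by
        rw [hext_out W l (fun ⟨i, hi⟩ => hl (Finset.mem_image.mpr ⟨i, Finset.mem_univ _, hi⟩)), pow_zero]),
      Finset.prod_image (fun i _ i' _ hii' => hιinj hii')]
    exact Finset.prod_congr rfl fun i _ => by rw [hext_app, hι]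
  have hcomp : (fun W : Fin m → Fin (p ^ j) => fmon g W) = (fun W' => fmon b W') ∘ ext :=
    funext fun W => (hmon W).symm
  unfold PIndep
  rw [hcomp]
  exact hb.comp ext hinj

/-- `z ∈ k^{p^j}(Λ) ⇒ z^{p^i} ∈ k^{p^{i+j}}(Λ)` for an arbitrary set `Λ` (set version of `pow_mem_adjoin`). [folklore] -/
theorem pow_mem_adjoin_set (Λ : Set k) (j i : ℕ) {z : k} (hz : z ∈ IntermediateField.adjoin (frobPow k p j) Λ) :
    z ^ p ^ i ∈ IntermediateField.adjoin (frobPow k p (i + j)) Λ := by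
  induction hz using IntermediateField.adjoin_induction with
  | mem x hx => exact pow_mem (IntermediateField.subset_adjoin _ _ hx) _
  | algebraMap κ =>
    have : ((κ : k)) ^ p ^ i ∈ frobPow k p (i + j) := by
      obtain ⟨w, hw⟩ := mem_frobPow_iff.mp κ.2
      refine mem_frobPow_iff.mpr ⟨w, ?_⟩
      rw [pow_add, mul_comm, pow_mul, hw]
    exact IntermediateField.algebraMap_mem _ (⟨_, this⟩ : frobPow k p (i + j))
  | add x y _ _ hx hy => rw [add_pow_char_pow]; exact add_mem hx hy
  | inv x _ hx => rw [inv_pow]; exact inv_mem hx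
  | mul x y _ _ hx hy => rw [mul_pow]; exact mul_mem hx hy

/-- **`k = k^p(Λ)` implies `k = k^{p^j}(Λ)` for every `j`**, arbitrary set `Λ`. [cite: Mizutani1973HironakaGroupSchemes, Lemma 2.4 (p. 88)] -/
theorem adjoin_frobPow_eq_top_all (Λ : Set k) (htop : IntermediateField.adjoin (frobPow k p 1) Λ = ⊤) :
    ∀ j : ℕ, IntermediateField.adjoin (frobPow k p j) Λ = ⊤
  | 0 => eq_top_iff.mpr fun y _ => IntermediateField.algebraMap_mem _ (⟨y, mem_frobPow_zero y⟩ : frobPow k p 0)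
  | j + 1 => by
    have ih := adjoin_frobPow_eq_top_all Λ htop j
    have key : ∀ y, y ∈ IntermediateField.adjoin (frobPow k p 1) Λ →
        y ∈ IntermediateField.adjoin (frobPow k p (j + 1)) Λ := by
      intro y hy
      induction hy using IntermediateField.adjoin_induction with
      | mem x hx => exact IntermediateField.subset_adjoin _ _ hx
      | algebraMap κ =>
        obtain ⟨w, hw⟩ := mem_frobPow_iff.mp κ.2
        have hwj : w ∈ IntermediateField.adjoin (frobPow k p j) Λ := by rw [ih]; trivial
        have := pow_mem_adjoin_set Λ j 1 hwj
        rw [Nat.add_comm 1 j, hw] at this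
        exact this
      | add x y _ _ hx hy => exact add_mem hx hy
      | inv x _ hx => exact inv_mem hx
      | mul x y _ _ hx hy => exact mul_mem hx hy
    exact eq_top_iff.mpr fun y _ => key y (by rw [htop]; trivial)

/-- **EVERY FINITE `p`-INDEPENDENT FAMILY EXTENDS TO A `p`-BASIS** (Zorn): there is `Λ ⊇ range b` whose finite injective subfamilies are all
`p`-independent and which generates `k` over `k^p`.  A maximal such `Λ` generates: otherwise some `y ∉ k^p(Λ)`, and `Λ ∪ {y}` is still
`p`-independent by the exchange lemma `PIndep.cons`. [cite: Mizutani1973HironakaGroupSchemes, Lemma 2.4 (p. 88: a p-basis Λ of k over k^p)] -/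
theorem exists_pBasis_superset {s : ℕ} {b : Fin s → k} (hb : PIndep p 1 b) :
    ∃ Λ : Set k, Set.range b ⊆ Λ ∧
      (∀ (m : ℕ) (g : Fin m → k), Function.Injective g → Set.range g ⊆ Λ → PIndep p 1 g) ∧
      IntermediateField.adjoin (frobPow k p 1) Λ = ⊤ := by
  classical
  set S : Set (Set k) := {Λ | Set.range b ⊆ Λ ∧
    ∀ (m : ℕ) (g : Fin m → k), Function.Injective g → Set.range g ⊆ Λ → PIndep p 1 g} with hS
  have h0 : Set.range b ∈ S := ⟨subset_rfl, fun m g hg hsub => hb.of_range_subset hg hsub⟩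
  -- chains have upper bounds: a finite family drawn from `⋃ c` is drawn from one member of the chain
  have hchain : ∀ c ⊆ S, IsChain (· ⊆ ·) c → c.Nonempty → ∃ ub ∈ S, ∀ s ∈ c, s ⊆ ub := by
    intro c hcS hc hne
    obtain ⟨Λ₀, hΛ₀⟩ := hne
    refine ⟨⋃₀ c, ⟨(hcS hΛ₀).1.trans (Set.subset_sUnion_of_mem hΛ₀), fun m g hg hsub => ?_⟩,
      fun s hs => Set.subset_sUnion_of_mem hs⟩
    rcases Nat.eq_zero_or_pos m with rfl | hm
    · exact pIndep_empty 1 g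
    · haveI : Nonempty (Fin m) := ⟨⟨0, hm⟩⟩
      have hex : ∀ i : Fin m, ∃ Λ ∈ c, g i ∈ Λ := fun i => Set.mem_sUnion.mp (hsub ⟨i, rfl⟩)
      choose Λi hΛc hgi using hex
      have hdir : Directed (· ⊆ ·) Λi := fun i i' => by
        rcases hc.total (hΛc i) (hΛc i') with h | h
        · exact ⟨i', h, subset_rfl⟩
        · exact ⟨i, subset_rfl, h⟩
      obtain ⟨z, hz⟩ := hdir.finset_le Finset.univ
      refine (hcS (hΛc z)).2 m g hg ?_
      rintro _ ⟨i, rfl⟩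
      exact hz i (Finset.mem_univ i) (hgi i)
  obtain ⟨Λ, hbΛ, hmax⟩ := zorn_subset_nonempty S hchain (Set.range b) h0
  have hΛ : Λ ∈ S := hmax.prop
  refine ⟨Λ, hbΛ, hΛ.2, ?_⟩
  by_contra hne
  obtain ⟨y, hy⟩ : ∃ y, y ∉ IntermediateField.adjoin (frobPow k p 1) Λ := by
    contrapose! hne
    exact eq_top_iff.mpr fun y _ => hne y
  have hyΛ : y ∉ Λ := fun h => hy (IntermediateField.subset_adjoin _ _ h)
  -- `Λ ∪ {y}` is again in `S`
  have hins : insert y Λ ∈ S := by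
    refine ⟨hbΛ.trans (Set.subset_insert _ _), fun m g hg hsub => ?_⟩
    by_cases hyg : y ∈ Set.range g
    · obtain ⟨i₀, rfl⟩ := hyg
      cases m with
      | zero => exact Fin.elim0 i₀
      | succ m' =>
        set g' : Fin m' → k := g ∘ i₀.succAbove with hg'
        have hg'inj : Function.Injective g' := hg.comp Fin.succAbove_right_injective
        have hg'Λ : Set.range g' ⊆ Λ := by
          rintro _ ⟨j, rfl⟩
          have hne' : g' j ≠ g i₀ := fun h => Fin.succAbove_ne i₀ j (hg h)
          rcases hsub ⟨i₀.succAbove j, rfl⟩ with h | h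
          · exact absurd h hne'
          · exact h
        have hPg' : PIndep p 1 g' := hΛ.2 m' g' hg'inj hg'Λ
        have hyg' : g i₀ ∉ IntermediateField.adjoin (frobPow k p 1) (Set.range g') :=
          fun h => hy (IntermediateField.adjoin.mono _ _ _ hg'Λ h)
        have hcons : PIndep p 1 (Fin.cons (g i₀) g' : Fin (m' + 1) → k) := hPg'.cons hyg'
        refine hcons.of_range_subset hg ?_
        rintro _ ⟨i, rfl⟩
        by_cases hi : i = i₀
        · exact ⟨0, by rw [hi]; rfl⟩
        · obtain ⟨j, rfl⟩ := Fin.exists_succAbove_eq hi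
          exact ⟨j.succ, by rw [Fin.cons_succ]; rfl⟩
    · refine hΛ.2 m g hg ?_
      rintro _ ⟨i, rfl⟩
      rcases hsub ⟨i, rfl⟩ with h | h
      · exact absurd ⟨i, h⟩ hyg
      · exact h
  have := hmax.eq_of_subset hins (Set.subset_insert _ _)
  exact hyΛ (this ▸ Set.mem_insert y Λ)

/-- **Every field of characteristic `p` has a `p`-basis** (in the finite-subfamily sense). [cite: Mizutani1973HironakaGroupSchemes, Lemma 2.4 (p. 88)] -/
theorem exists_pBasis (k : Type u) [Field k] (p : ℕ) [Fact p.Prime] [CharP k p] :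
    ∃ Λ : Set k, (∀ (m : ℕ) (g : Fin m → k), Function.Injective g → Set.range g ⊆ Λ → PIndep p 1 g) ∧
      IntermediateField.adjoin (frobPow k p 1) Λ = ⊤ := by
  obtain ⟨Λ, -, hΛ, htop⟩ := exists_pBasis_superset (pIndep_empty (k := k) (p := p) 1 Fin.elim0)
  exact ⟨Λ, hΛ, htop⟩

/-- A `p`-basis generates `k` over `k^{p^j}` for every `j`: `k = k^{p^j}(Λ)`. [cite: Mizutani1973HironakaGroupSchemes, Lemma 2.4 (p. 88: K = k^q(c_1, …, c_m))] -/
theorem adjoin_frobPow_pBasis_eq_top {Λ : Set k} (htop : IntermediateField.adjoin (frobPow k p 1) Λ = ⊤) (j : ℕ) :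
    IntermediateField.adjoin (frobPow k p j) Λ = ⊤ :=
  adjoin_frobPow_eq_top_all Λ htop j

/-- The finite subfamilies of a `p`-basis are `p`-independent at every level `j ≥ 1`. [cite: Mizutani1973HironakaGroupSchemes, Lemma 2.4 (p. 88)] -/
theorem pIndep_of_pBasis {Λ : Set k}
    (hΛ : ∀ (m : ℕ) (g : Fin m → k), Function.Injective g → Set.range g ⊆ Λ → PIndep p 1 g)
    {m : ℕ} {g : Fin m → k} (hg : Function.Injective g) (hsub : Set.range g ⊆ Λ) {j : ℕ} (hj : 1 ≤ j) : PIndep p j g :=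
  (hΛ m g hg hsub).of_one j hj

end PBasis

end Summit.ResolutionOfSingularities.KangarooAtlas.Mizutani

end
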